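import Summits.ValiantsHypothesis.ValiantsHypothesis.Theorems.LacunarySymmetroidMatrixDescartesFiniteSectorSectorCeilingSixtytwoFourVA
import Summits.ValiantsHypothesis.ValiantsHypothesis.Theorems.LacunarySymmetroidMatrixDescartesFiniteSectorSectorCeilingSixtytwoFourVB
import Summits.ValiantsHypothesis.ValiantsHypothesis.Theorems.LacunarySymmetroidMatrixDescartesFiniteSectorSectorCeilingSixtytwoFourVC
import Summits.ValiantsHypothesis.ValiantsHypothesis.Theorems.LacunarySymmetroidMatrixDescartesFiniteSectorSectorCeilingSixtytwoFourVH
import Summits.ValiantsHypothesis.ValiantsHypothesis.Theorems.LacunarySymmetroidMatrixDescartesFiniteSectorSectorCeilingSixtytwoFourVI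
import Summits.ValiantsHypothesis.ValiantsHypothesis.Theorems.LacunarySymmetroidMatrixDescartesFiniteSectorSectorCeilingSixtytwoFourVJ
import Summits.ValiantsHypothesis.ValiantsHypothesis.Theorems.LacunarySymmetroidMatrixDescartesFiniteSectorSectorCeilingSixtytwoFourVK
import Summits.ValiantsHypothesis.ValiantsHypothesis.Theorems.LacunarySymmetroidMatrixDescartesFiniteSectorSectorCeilingSixtytwoFourVL
import Summits.ValiantsHypothesis.ValiantsHypothesis.Theorems.LacunarySymmetroidMatrixDescartesFiniteSectorSectorCeilingSixtytwoFourVM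
import Summits.ValiantsHypothesis.ValiantsHypothesis.Theorems.LacunarySymmetroidMatrixDescartesFiniteSectorSectorCeilingSixtytwoFourVN
import Summits.ValiantsHypothesis.ValiantsHypothesis.Theorems.LacunarySymmetroidMatrixDescartesFiniteSectorSectorCeilingSixtytwoFourVO
import Summits.ValiantsHypothesis.ValiantsHypothesis.Theorems.LacunarySymmetroidMatrixDescartesFiniteSectorSectorCeilingSixtytwoFourVP
import Summits.ValiantsHypothesis.ValiantsHypothesis.Theorems.LacunarySymmetroidMatrixDescartesFiniteSectorSectorCeilingSixtytwoFourVQ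
import Summits.ValiantsHypothesis.ValiantsHypothesis.Theorems.LacunarySymmetroidMatrixDescartesFiniteSectorIterMasksWalk
import Summits.ValiantsHypothesis.ValiantsHypothesis.Theorems.LacunarySymmetroidMatrixDescartesFiniteSector

/-!
# `MatrixDescartes` — line «finite»: the SECTOR CEILING `η(62,4) ≤ σ(62,4) = 28972` (kernel) — `HypRootLawAt 62 4 28972`, Conjecture Σ's value `2·n(62,3)`

HONEST FRAMING.  Object-search cell `pub-symmetroid`, seat val-sym-door-p5 g12.  HELPER of the crux item `stmt-ValiantsHypothesis-18050` (`Theses.LacunarySymmetroid.MatrixDescartes`)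
with NO closure claim.  The SIEVE of line «finite» (`FiniteSector.sieve`, `natDegree_mem_sumset`) makes the `62`-fold sums of exponents of an in-sector pencil a
step-≤-2 chain from `0` up to the degree; the finite core — no `3` positive values carry such a chain beyond `28972` — has 218 150 live prefixes and is
decided in the kernel in the WALKER shape of `…FiniteSectorIterMasksWalk` (seat val-sym-door-p5 g12; TWO-LEVEL slices `sectorWalk_sixtytwo_four_s2_*_s3_*` (two-level slicing: seat val-sym-door-p5 g12) in `…FiniteSectorSectorCeilingSixtytwoFourVA`, `…FiniteSectorSectorCeilingSixtytwoFourVB`, `…FiniteSectorSectorCeilingSixtytwoFourVC`, `…FiniteSectorSectorCeilingSixtytwoFourVH`, `…FiniteSectorSectorCeilingSixtytwoFourVI`, `…FiniteSectorSectorCeilingSixtytwoFourVJ`, `…FiniteSectorSectorCeilingSixtytwoFourVK`, `…FiniteSectorSectorCeilingSixtytwoFourVL`, `…FiniteSectorSectorCeilingSixtytwoFourVM`, `…FiniteSectorSectorCeilingSixtytwoFourVN`, `…FiniteSectorSectorCeilingSixtytwoFourVO`, `…FiniteSectorSectorCeilingSixtytwoFourVP`, `…FiniteSectorSectorCeilin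gSixtytwoFourVQ`);
the transfer reads the census sum set as capped multisets and peels the walker level by level (`walk_true`).  Result: `hypRootLawAt_sixtytwo_four_28972 : HypRootLawAt 62 4 28972`.
Located first (exact DFS): the chain survives to `28971` only on the doubled extremal basis `2·{0,1,46,660}` — `σ(62,4) = 28972 = 2·n(62,3)`, Conjecture Σ of `Lines/finite.md` at the cell
`(62,4)`; the lower side needs a realised doubled basis and is NOT claimed here.  Nothing here bears on the crux (asymptotic), on `H3`, on the doors, or on `VP ≠ VNP`.
[folklore] Gap-rule / sieve bookkeeping plus a finite enumeration (postage-stamp numbers `n(62,·)`); no citation is load-bearing.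
-/

-- `Summit.ValiantsHypothesis.ValiantsHypothesis.…` repeats a component by the D-0017 layout
-- (single-conjunct summit), which the `dupNamespace` linter flags; the name is mandated.
set_option linter.dupNamespace false

namespace Summit.ValiantsHypothesis.ValiantsHypothesis.Theorems.LacunarySymmetroidMatrixDescartes.FiniteSector

open scoped BigOperators Matrix
open Polynomial

/-! ## `(62,4)`: `σ(62,4) = 28972` -/

set_option maxHeartbeats 4000000 in
set_option maxRecDepth 100000 in
/-- **`η(62,4) ≤ 28972 = σ(62,4)`** — `HypRootLawAt 62 4 28972`: every in-sector (`#distinct real roots = natDegree`) determinant of a real symmetric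
`62 × 62` lacunary pencil with `4` terms has degree `≤ 28972` (SIEVE ⇒ step-≤-2 chain of `62`-fold sums; values capped at `28975`, padded, sorted; capped
multisets; the kernel walker slices, peeled level by level with `walk_true`). [folklore] -/
theorem hypRootLawAt_sixtytwo_four_28972 : HypRootLawAt 62 4 28972 := by
  intro d S hS hsec
  by_contra hdeg'
  have hdeg : 28972 < (pencil d S).det.natDegree := not_le.mp hdeg'
  have hq : (pencil d S).det ≠ 0 := by
    intro h0; rw [h0] at hdeg; simp at hdeg
  have hchain0 : ∀ r, r + 2 ≤ (pencil d S).det.natDegree →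
      r ∈ (Finset.univ : Finset (Sym (Fin 4) 62)).image (fun s : Sym (Fin 4) 62 => ((s : Multiset (Fin 4)).map d).sum) ∨
      r + 1 ∈ (Finset.univ : Finset (Sym (Fin 4) 62)).image (fun s : Sym (Fin 4) 62 => ((s : Multiset (Fin 4)).map d).sum) :=
    fun r hr => sieve d S hq hsec hr
  have htop0 := natDegree_mem_sumset d S hq
  set cv : Fin 4 → ℕ := fun i => min (d i) 28975 with hcv
  have hcvle : ∀ i, cv i ≤ 28975 := fun i => Nat.min_le_right _ _
  set V : Finset ℕ := Finset.univ.image cv with hV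
  have hcvV : ∀ i, cv i ∈ V := fun i => Finset.mem_image_of_mem cv (Finset.mem_univ i)
  have h0V : 0 ∈ V := by
    have key : ∃ i : Fin 4, d i = 0 := by
      rcases hchain0 0 (by omega) with h | h
      · obtain ⟨i, hi⟩ := exists_index_eq_zero d 28975 (by norm_num) (by norm_num) h
        refine ⟨i, ?_⟩
        rcases Nat.lt_or_ge (d i) 28975 with hlt | hge
        · rwa [Nat.min_eq_left hlt.le] at hi
        · rw [Nat.min_eq_right hge] at hi
          omega
      · obtain ⟨t, ht, hcard, hsum⟩ := exists_multiset_of_mem_sumset d 28975 ((List.finRange 4).map (fun i => min (d i) 28975))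
          (fun i => List.mem_map.mpr ⟨i, List.mem_finRange i, rfl⟩) (by norm_num) h
        have hex : ∃ x ∈ t, x = 0 := by
          by_contra hall; push Not at hall; have h1 : ∀ x ∈ t, 1 ≤ x := fun x hx => Nat.one_le_iff_ne_zero.mpr (hall x hx); have := Multiset.card_nsmul_le_sum h1; rw [hcard] at this; simp at this; omega
        obtain ⟨x, hx, hx0⟩ := hex
        obtain ⟨j, -, hj⟩ := List.mem_map.mp (ht x hx)
        refine ⟨j, ?_⟩
        have := hj.trans hx0
        rcases Nat.lt_or_ge (d j) 28975 with hlt | hge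
        · rwa [Nat.min_eq_left hlt.le] at this
        · rw [Nat.min_eq_right hge] at this
          omega
    obtain ⟨i, hi⟩ := key
    have : cv i = 0 := by simp [hcv, hi]
    exact this ▸ hcvV i
  set W : Finset ℕ := V.erase 0 with hW
  have hWsub : W ⊆ (Finset.range 28976).erase 0 := by
    intro u hu; rw [hW, Finset.mem_erase] at hu; obtain ⟨hu0, huV⟩ := hu; rw [hV, Finset.mem_image] at huV; obtain ⟨i, -, rfl⟩ := huV; rw [Finset.mem_erase, Finset.mem_range]; exact ⟨hu0, Nat.lt_succ_of_le (hcvle i)⟩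
  have hWcard : W.card ≤ 3 := by
    have hVK : V.card ≤ 4 := by
      have := Finset.card_image_le (s := (Finset.univ : Finset (Fin 4))) (f := cv); simpa using this
    have h1 : W.card + 1 = V.card := by rw [hW]; exact Finset.card_erase_add_one h0V
    omega
  obtain ⟨W', hWW', hW'sub, hW'card⟩ := Finset.exists_subsuperset_card_eq hWsub hWcard
    (by rw [Finset.card_erase_of_mem (by simp), Finset.card_range]; omega)
  have hVW' : ∀ u ∈ V, u = 0 ∨ u ∈ W' := by
    intro u hu
    by_cases hu0 : u = 0
    · exact Or.inl hu0
    · exact Or.inr (hWW' (by rw [hW, Finset.mem_erase]; exact ⟨hu0, hu⟩))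
  have hlmem : ∀ u, u ∈ Finset.sort W' ↔ u ∈ W' := fun u => Finset.mem_sort _
  have hlsort : (Finset.sort W').SortedLT := Finset.sortedLT_sort W'
  have hllen : (Finset.sort W').length = 3 := by rw [Finset.length_sort, hW'card]
  generalize hl : Finset.sort W' = l at hlmem hlsort hllen
  rcases l with _ | ⟨a, _ | ⟨b, _ | ⟨c, _ | ⟨zz, ll⟩⟩⟩⟩
  all_goals simp only [List.length_cons, List.length_nil] at hllen
  all_goals try omega
  have hltC : ∀ u, u ∈ [a, b, c] → u < 28976 := by
    intro u hu; have hu' : u ∈ W' := (hlmem u).mp hu; have := hW'sub hu'; rw [Finset.mem_erase, Finset.mem_range] at this; exact this.2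
  have hgt : ∀ u, u ∈ [a, b, c] → 0 < u := by
    intro u hu; have hu' : u ∈ W' := (hlmem u).mp hu; have := hW'sub hu'; rw [Finset.mem_erase] at this; omega
  have hlt0 : 0 < a := hgt a (by simp)
  have hin : ∀ u ∈ V, u ∈ [0, a, b, c] := by
    intro u hu
    rcases hVW' u hu with h | h
    · rw [h]; simp
    · exact List.mem_cons_of_mem _ ((hlmem u).mpr h)
  have hL : ∀ i, min (d i) 28975 ∈ [0, a, b, c] := fun i => by
    have := hin _ (hcvV i)
    simpa only [hcv] using this
  have hsumP : ∀ r, r ≤ 28974 →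
      r ∈ (Finset.univ : Finset (Sym (Fin 4) 62)).image (fun s : Sym (Fin 4) 62 => ((s : Multiset (Fin 4)).map d).sum) →
      ∃ t : Multiset ℕ, (∀ x ∈ t, x ∈ [0, a, b, c]) ∧ Multiset.card t = 62 ∧ t.sum = r := by
    intro r hr hr'
    have key := exists_multiset_of_mem_sumset d 28975 [0, a, b, c] hL (Nat.lt_succ_of_le hr) hr'
    exact key
  have hchainP : ∀ r, r ≤ 28971 → (∃ t : Multiset ℕ, (∀ x ∈ t, x ∈ [0, a, b, c]) ∧ Multiset.card t = 62 ∧ t.sum = r) ∨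
      (∃ t : Multiset ℕ, (∀ x ∈ t, x ∈ [0, a, b, c]) ∧ Multiset.card t = 62 ∧ t.sum = r + 1) := by
    intro r hr
    rcases hchain0 r (by omega) with h | h
    · exact Or.inl (hsumP r (by omega) h)
    · exact Or.inr (hsumP (r + 1) (by omega) h)
  have hlt1 : a < b := by
    have := hlsort (show (⟨0, by simp⟩ : Fin [a, b, c].length) < ⟨1, by simp⟩ from Fin.mk_lt_mk.mpr (by norm_num)); simpa using this
  have hlt2 : b < c := by
    have := hlsort (show (⟨1, by simp⟩ : Fin [a, b, c].length) < ⟨2, by simp⟩ from Fin.mk_lt_mk.mpr (by norm_num)); simpa using this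
  have hC0 : a < 28976 := hltC a (by simp)
  have hC1 : b < 28976 := hltC b (by simp)
  have hC2 : c < 28976 := hltC c (by simp)
  have hrest0 : ∀ y ∈ [a, b, c], a ≤ y := by
    intro y hy; simp only [List.mem_cons, List.mem_nil_iff, or_false] at hy; omega
  have halive0 : ∀ r < min 28972 (a - 1), ((@Nat.rec (fun _ => ℕ) ((fun (E : ℕ) => @List.rec ℕ (fun _ => ℕ) 0 (fun (x : ℕ) (_ : List ℕ) (acc : ℕ) => Nat.lor acc (Nat.shiftLeft E x)) [0]) 1) (fun (_ acc : ℕ) => (fun (E : ℕ) => @List.rec ℕ (fun _ => ℕ) 0 (fun (x : ℕ) (_ : List ℕ) (acc : ℕ) => Nat.lor acc (Nat.shiftLeft E x)) [0]) acc) 61)).testBit r = true ∨ ((@Nat.rec (fun _ => ℕ) ((fun (E : ℕ) => @List.rec ℕ (fun _ => ℕ) 0 (fun (x : ℕ) (_ : List ℕ) (acc : ℕ) => Nat.lor acc (Nat.shiftLeft E x)) [0]) 1) (fun (_ acc : ℕ) => (fun (E : ℕ) => @List.rec ℕ (fun _ => ℕ) 0 (fun (x : ℕ) (_ : List ℕ)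 (acc : ℕ) => Nat.lor acc (Nat.shiftLeft E x)) [0]) acc) 61)).testBit (r + 1) = true := by
    intro r hr
    rcases hchainP r (by omega) with ⟨t, ht, hcard, hsum⟩ | ⟨t, ht, hcard, hsum⟩
    · have ht' := multiset_prefix (l₁ := [0]) (l₂ := [a, b, c]) hrest0 (by omega) ht
      rw [← hsum]
      exact Or.inl (testBit_lagMask_of_multiset [0] 61 t ht' hcard)
    · have ht' := multiset_prefix (l₁ := [0]) (l₂ := [a, b, c]) hrest0 (by omega) ht
      rw [← hsum]
      exact Or.inr (testBit_lagMask_of_multiset [0] 61 t ht' hcard)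
  have hz0 : ((@Nat.rec (fun _ => ℕ) ((fun (E : ℕ) => @List.rec ℕ (fun _ => ℕ) 0 (fun (x : ℕ) (_ : List ℕ) (acc : ℕ) => Nat.lor acc (Nat.shiftLeft E x)) [0]) 1) (fun (_ acc : ℕ) => (fun (E : ℕ) => @List.rec ℕ (fun _ => ℕ) 0 (fun (x : ℕ) (_ : List ℕ) (acc : ℕ) => Nat.lor acc (Nat.shiftLeft E x)) [0]) acc) 61)).testBit 0 = true := testBit_lagMask_zero [0] 61 (by simp)
  have hg0 := alive_guards (Mp := (@Nat.rec (fun _ => ℕ) ((fun (E : ℕ) => @List.rec ℕ (fun _ => ℕ) 0 (fun (x : ℕ) (_ : List ℕ) (acc : ℕ) => Nat.lor acc (Nat.shiftLeft E x)) [0]) 1) (fun (_ acc : ℕ) => (fun (E : ℕ) => @List.rec ℕ (fun _ => ℕ) 0 (fun (x : ℕ) (_ : List ℕ) (acc : ℕ) => Nat.lor acc (Nat.shiftLeft E x)) [0]) acc) 61)) (lo := 0) (T := 28972) (c := a) hz0 halive0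
  have hrest1 : ∀ y ∈ [b, c], b ≤ y := by
    intro y hy; simp only [List.mem_cons, List.mem_nil_iff, or_false] at hy; omega
  have halive1 : ∀ r < min 28972 (b - 1), ((@Nat.rec (fun _ => ℕ) ((fun (E : ℕ) => @List.rec ℕ (fun _ => ℕ) 0 (fun (x : ℕ) (_ : List ℕ) (acc : ℕ) => Nat.lor acc (Nat.shiftLeft E x)) [0, a]) 1) (fun (_ acc : ℕ) => (fun (E : ℕ) => @List.rec ℕ (fun _ => ℕ) 0 (fun (x : ℕ) (_ : List ℕ) (acc : ℕ) => Nat.lor acc (Nat.shiftLeft E x)) [0, a]) acc) 61)).testBit r = true ∨ ((@Nat.rec (fun _ => ℕ) ((fun (E : ℕ) => @List.rec ℕ (fun _ => ℕ) 0 (fun (x : ℕ) (_ : List ℕ) (acc : ℕ) => Nat.lor acc (Nat.shiftLeft E x)) [0, a]) 1) (fun (_ acc : ℕ) => (fun (E : ℕ) => @List.rec ℕ (fun _ => ℕ) 0 (fun (x : ℕ) (_ : List ℕ) (acc : ℕ) => Nat.lor acc (Nat.shiftLeft E x)) [0, a]) acc) 61)).testBit (r + 1) = true := by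
    intro r hr
    rcases hchainP r (by omega) with ⟨t, ht, hcard, hsum⟩ | ⟨t, ht, hcard, hsum⟩
    · have ht' := multiset_prefix (l₁ := [0, a]) (l₂ := [b, c]) hrest1 (by omega) ht
      rw [← hsum]
      exact Or.inl (testBit_lagMask_of_multiset [0, a] 61 t ht' hcard)
    · have ht' := multiset_prefix (l₁ := [0, a]) (l₂ := [b, c]) hrest1 (by omega) ht
      rw [← hsum]
      exact Or.inr (testBit_lagMask_of_multiset [0, a] 61 t ht' hcard)
  have hz1 : ((@Nat.rec (fun _ => ℕ) ((fun (E : ℕ) => @List.rec ℕ (fun _ => ℕ) 0 (fun (x : ℕ) (_ : List ℕ) (acc : ℕ) => Nat.lor acc (Nat.shiftLeft E x)) [0, a]) 1) (fun (_ acc : ℕ) => (fun (E : ℕ) => @List.rec ℕ (fun _ => ℕ) 0 (fun (x : ℕ) (_ : List ℕ) (acc : ℕ) => Nat.lor acc (Nat.shiftLeft E x)) [0, a]) acc) 61)).testBit 0 = true := testBit_lagMask_zero [0, a] 61 (by simp)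
  have hg1 := alive_guards (Mp := (@Nat.rec (fun _ => ℕ) ((fun (E : ℕ) => @List.rec ℕ (fun _ => ℕ) 0 (fun (x : ℕ) (_ : List ℕ) (acc : ℕ) => Nat.lor acc (Nat.shiftLeft E x)) [0, a]) 1) (fun (_ acc : ℕ) => (fun (E : ℕ) => @List.rec ℕ (fun _ => ℕ) 0 (fun (x : ℕ) (_ : List ℕ) (acc : ℕ) => Nat.lor acc (Nat.shiftLeft E x)) [0, a]) acc) 61)) (lo := a) (T := 28972) (c := b) hz1 halive1
  have hrest2 : ∀ y ∈ [c], c ≤ y := by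
    intro y hy; simp only [List.mem_cons, List.mem_nil_iff, or_false] at hy; omega
  have halive2 : ∀ r < min 28972 (c - 1), ((@Nat.rec (fun _ => ℕ) ((fun (E : ℕ) => @List.rec ℕ (fun _ => ℕ) 0 (fun (x : ℕ) (_ : List ℕ) (acc : ℕ) => Nat.lor acc (Nat.shiftLeft E x)) [0, a, b]) 1) (fun (_ acc : ℕ) => (fun (E : ℕ) => @List.rec ℕ (fun _ => ℕ) 0 (fun (x : ℕ) (_ : List ℕ) (acc : ℕ) => Nat.lor acc (Nat.shiftLeft E x)) [0, a, b]) acc) 61)).testBit r = true ∨ ((@Nat.rec (fun _ => ℕ) ((fun (E : ℕ) => @List.rec ℕ (fun _ => ℕ) 0 (fun (x : ℕ) (_ : List ℕ) (acc : ℕ) => Nat.lor acc (Nat.shiftLeft E x)) [0, a, b]) 1) (fun (_ acc : ℕ) => (fun (E : ℕ) => @List.rec ℕ (fun _ => ℕ) 0 (fun (x : ℕ) (_ : List ℕ) (acc : ℕ) => Nat.lor acc (Nat.shiftLeft E x)) [0, a, b]) acc) 61)).testBit (r + 1) = true := by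
    intro r hr
    rcases hchainP r (by omega) with ⟨t, ht, hcard, hsum⟩ | ⟨t, ht, hcard, hsum⟩
    · have ht' := multiset_prefix (l₁ := [0, a, b]) (l₂ := [c]) hrest2 (by omega) ht
      rw [← hsum]
      exact Or.inl (testBit_lagMask_of_multiset [0, a, b] 61 t ht' hcard)
    · have ht' := multiset_prefix (l₁ := [0, a, b]) (l₂ := [c]) hrest2 (by omega) ht
      rw [← hsum]
      exact Or.inr (testBit_lagMask_of_multiset [0, a, b] 61 t ht' hcard)
  have hz2 : ((@Nat.rec (fun _ => ℕ) ((fun (E : ℕ) => @List.rec ℕ (fun _ => ℕ) 0 (fun (x : ℕ) (_ : List ℕ) (acc : ℕ) => Nat.lor acc (Nat.shiftLeft E x)) [0, a, b]) 1) (fun (_ acc : ℕ) => (fun (E : ℕ) => @List.rec ℕ (fun _ => ℕ) 0 (fun (x : ℕ) (_ : List ℕ) (acc : ℕ) => Nat.lor acc (Nat.shiftLeft E x)) [0, a, b]) acc) 61)).testBit 0 = true := testBit_lagMask_zero [0, a, b] 61 (by simp)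
  have hg2 := alive_guards (Mp := (@Nat.rec (fun _ => ℕ) ((fun (E : ℕ) => @List.rec ℕ (fun _ => ℕ) 0 (fun (x : ℕ) (_ : List ℕ) (acc : ℕ) => Nat.lor acc (Nat.shiftLeft E x)) [0, a, b]) 1) (fun (_ acc : ℕ) => (fun (E : ℕ) => @List.rec ℕ (fun _ => ℕ) 0 (fun (x : ℕ) (_ : List ℕ) (acc : ℕ) => Nat.lor acc (Nat.shiftLeft E x)) [0, a, b]) acc) 61)) (lo := b) (T := 28972) (c := c) hz2 halive2
  have hleafA : Nat.beq (Nat.mod (Nat.lor (@Nat.rec (fun _ => ℕ) 1 (fun (k acc : ℕ) => Nat.lor (@Nat.rec (fun _ => ℕ) ((fun (E : ℕ) => @List.rec ℕ (fun _ => ℕ) 0 (fun (x : ℕ) (_ : List ℕ) (acc : ℕ) => Nat.lor acc (Nat.shiftLeft E x)) [0, a, b]) 1) (fun (_ acc : ℕ) => (fun (E : ℕ) => @List.rec ℕ (fun _ => ℕ) 0 (fun (x : ℕ) (_ : List ℕ) (acc : ℕ) => Nat.lor acc (Nat.shiftLeft E x)) [0, a, b]) acc) k) (Nat.shiftLeft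 acc c)) 62) (Nat.div (@Nat.rec (fun _ => ℕ) 1 (fun (k acc : ℕ) => Nat.lor (@Nat.rec (fun _ => ℕ) ((fun (E : ℕ) => @List.rec ℕ (fun _ => ℕ) 0 (fun (x : ℕ) (_ : List ℕ) (acc : ℕ) => Nat.lor acc (Nat.shiftLeft E x)) [0, a, b]) 1) (fun (_ acc : ℕ) => (fun (E : ℕ) => @List.rec ℕ (fun _ => ℕ) 0 (fun (x : ℕ) (_ : List ℕ) (acc : ℕ) => Nat.lor acc (Nat.shiftLeft E x)) [0, a, b]) acc) k) (Nat.shiftLeft acc c)) 62) 2)) (2 ^ 28972)) (2 ^ 28972 - 1) = true := by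
    apply rawAlive_of_testBit (t := 28972)
    intro r hr
    rcases hchainP r (by omega) with ⟨t, ht, hcard, hsum⟩ | ⟨t, ht, hcard, hsum⟩
    · rw [← hsum]
      exact Or.inl (testBit_incMask2_of_multiset [0, a, b] c 62 t ht hcard)
    · rw [← hsum]
      exact Or.inr (testBit_incMask2_of_multiset [0, a, b] c 62 t ht hcard)
  have hbit : ∀ r, r ≤ 28974 →
      r ∈ (Finset.univ : Finset (Sym (Fin 4) 62)).image (fun s : Sym (Fin 4) 62 => ((s : Multiset (Fin 4)).map d).sum) →
      Nat.beq (Nat.mod (Nat.div (@Nat.rec (fun _ => ℕ) 1 (fun (k acc : ℕ) => Nat.lor (@Nat.rec (fun _ => ℕ) ((fun (E : ℕ) => @List.rec ℕ (fun _ => ℕ) 0 (fun (x : ℕ) (_ : List ℕ) (acc : ℕ) => Nat.lor acc (Nat.shiftLeft E x)) [0, a, b]) 1) (fun (_ acc : ℕ) => (fun (E : ℕ) => @List.rec ℕ (fun _ => ℕ) 0 (fun (x : ℕ) (_ : List ℕ) (acc : ℕ) => Nat.lor acc (Nat.shiftLeft E x)) [0, a, b]) acc) k) (Nat.shiftLeft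 acc c)) 62) (2 ^ r)) 2) 1 = true := by
    intro r hr hr'
    obtain ⟨t, ht, hcard, hsum⟩ := hsumP r hr hr'
    rw [rawBit_eq_true_iff', ← hsum]
    exact testBit_incMask2_of_multiset [0, a, b] c 62 t ht hcard
  have peel : ∀ (Z LO HI LO' HI' : ℕ), Z = 1 → LO ≤ b → b < HI → LO' ≤ c → c < HI' →
      (@Nat.rec (fun _ => ℕ → Bool) (fun _ => true) (fun (_ : ℕ) (ih : ℕ → Bool) (a : ℕ) => cond ((Nat.ble (28972 + 2) a || Nat.beq (Nat.mod (Nat.div (Nat.lor (@Nat.rec (fun _ => ℕ) ((fun (E : ℕ) => @List.rec ℕ (fun _ => ℕ) 0 (fun (x : ℕ) (_ : List ℕ) (acc : ℕ) => Nat.lor acc (Nat.shiftLeft E x)) [0]) 1) (fun (_ acc : ℕ) => (fun (E : ℕ) => @List.rec ℕ (fun _ => ℕ) 0 (fun (x : ℕ) (_ : List ℕ) (acc : ℕ) => Nat.lor acc (Nat.shiftLeft E x)) [0]) acc) 61) (Nat.div (@Nat.rec (fun _ => ℕ) ((fun (E : ℕ) => @List.rec ℕ (fun _ => ℕ) 0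 (fun (x : ℕ) (_ : List ℕ) (acc : ℕ) => Nat.lor acc (Nat.shiftLeft E x)) [0]) 1) (fun (_ acc : ℕ) => (fun (E : ℕ) => @List.rec ℕ (fun _ => ℕ) 0 (fun (x : ℕ) (_ : List ℕ) (acc : ℕ) => Nat.lor acc (Nat.shiftLeft E x)) [0]) acc) 61) 2)) (Nat.pow 2 (a - 2))) 2) 1)) (((@Nat.rec (fun _ => ℕ → Bool) (fun _ => true) (fun (_ : ℕ) (ih : ℕ → Bool) (b : ℕ) => cond (Nat.beq (Nat.mod (Nat.lor (@Nat.rec (fun _ => ℕ) ((fun (E : ℕ) => @List.rec ℕ (fun _ => ℕ) 0 (fun (x : ℕ) (_ : List ℕ) (acc : ℕ) => Nat.lor acc (Nat.shiftLeft E x)) [0, a]) 1) (fun (_ acc : ℕ) => (fun (E : ℕ) => @List.rec ℕ (fun _ => ℕ) 0 (fun (x : ℕ) (_ : List ℕ) (acc : ℕ) => Nat.lor acc (Nat.shiftLeft E x)) [0, a]) acc) 61) (Nat.div (@Nat.rec (fun _ => ℕ) ((fun (E : ℕ) => @List.rec ℕ (fun _ => ℕ) 0 (fun (x : ℕ) (_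 : List ℕ) (acc : ℕ) => Nat.lor acc (Nat.shiftLeft E x)) [0, a]) 1) (fun (_ acc : ℕ) => (fun (E : ℕ) => @List.rec ℕ (fun _ => ℕ) 0 (fun (x : ℕ) (_ : List ℕ) (acc : ℕ) => Nat.lor acc (Nat.shiftLeft E x)) [0, a]) acc) 61) 2)) (2 ^ ((b - 1) - ((b - 1) - 28972)))) (2 ^ ((b - 1) - ((b - 1) - 28972)) - 1)) (((@Nat.rec (fun _ => ℕ → Bool) (fun _ => true) (fun (_ : ℕ) (ih : ℕ → Bool) (c : ℕ) => cond (Nat.beq (Nat.mod (Nat.lor (@Nat.rec (fun _ => ℕ) ((fun (E : ℕ) => @List.rec ℕ (fun _ => ℕ) 0 (fun (x : ℕ) (_ : List ℕ) (acc : ℕ) => Nat.lor acc (Nat.shiftLeft E x)) [0, a, b]) 1) (fun (_ acc : ℕ) => (fun (E : ℕ) => @List.rec ℕ (fun _ => ℕ) 0 (fun (x : ℕ) (_ : List ℕ) (acc : ℕ) => Nat.lor acc (Nat.shiftLeft E x)) [0, a, b]) acc) 61) (Nat.div (@Nat.rec (fun _ => ℕ) ((fun (E : ℕ) => @List.rec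 ℕ (fun _ => ℕ) 0 (fun (x : ℕ) (_ : List ℕ) (acc : ℕ) => Nat.lor acc (Nat.shiftLeft E x)) [0, a, b]) 1) (fun (_ acc : ℕ) => (fun (E : ℕ) => @List.rec ℕ (fun _ => ℕ) 0 (fun (x : ℕ) (_ : List ℕ) (acc : ℕ) => Nat.lor acc (Nat.shiftLeft E x)) [0, a, b]) acc) 61) 2)) (2 ^ ((c - 1) - ((c - 1) - 28972)))) (2 ^ ((c - 1) - ((c - 1) - 28972)) - 1)) (((!(Nat.beq (Nat.mod (Nat.lor (@Nat.rec (fun _ => ℕ) 1 (fun (k acc : ℕ) => Nat.lor (@Nat.rec (fun _ => ℕ) ((fun (E : ℕ) => @List.rec ℕ (fun _ => ℕ) 0 (fun (x : ℕ) (_ : List ℕ) (acc : ℕ) => Nat.lor acc (Nat.shiftLeft E x)) [0, a, b]) 1) (fun (_ acc : ℕ) => (fun (E : ℕ) => @List.rec ℕ (fun _ => ℕ) 0 (fun (x : ℕ) (_ : List ℕ) (acc : ℕ) => Nat.lor acc (Nat.shiftLeft E x)) [0, a, b]) acc) k) (Nat.shiftLeft acc c)) 62) (Nat.div (@Nat.rec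 (fun _ => ℕ) 1 (fun (k acc : ℕ) => Nat.lor (@Nat.rec (fun _ => ℕ) ((fun (E : ℕ) => @List.rec ℕ (fun _ => ℕ) 0 (fun (x : ℕ) (_ : List ℕ) (acc : ℕ) => Nat.lor acc (Nat.shiftLeft E x)) [0, a, b]) 1) (fun (_ acc : ℕ) => (fun (E : ℕ) => @List.rec ℕ (fun _ => ℕ) 0 (fun (x : ℕ) (_ : List ℕ) (acc : ℕ) => Nat.lor acc (Nat.shiftLeft E x)) [0, a, b]) acc) k) (Nat.shiftLeft acc c)) 62) 2)) (2 ^ 28972)) (2 ^ 28972 - 1)) || (!(Nat.beq (Nat.mod (Nat.div (@Nat.rec (fun _ => ℕ) 1 (fun (k acc : ℕ) => Nat.lor (@Nat.rec (fun _ => ℕ) ((fun (E : ℕ) => @List.rec ℕ (fun _ => ℕ) 0 (fun (x : ℕ) (_ : List ℕ) (acc : ℕ) => Nat.lor acc (Nat.shiftLeft E x)) [0, a, b]) 1) (fun (_ acc : ℕ) => (fun (E : ℕ) => @List.rec ℕ (fun _ => ℕ) 0 (fun (x : ℕ) (_ : List ℕ) (acc : ℕ) => Nat.lor acc (Nat.shiftLeft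 E x)) [0, a, b]) acc) k) (Nat.shiftLeft acc c)) 62) (2 ^ 28973)) 2) 1) && (!(Nat.beq (Nat.mod (Nat.div (@Nat.rec (fun _ => ℕ) 1 (fun (k acc : ℕ) => Nat.lor (@Nat.rec (fun _ => ℕ) ((fun (E : ℕ) => @List.rec ℕ (fun _ => ℕ) 0 (fun (x : ℕ) (_ : List ℕ) (acc : ℕ) => Nat.lor acc (Nat.shiftLeft E x)) [0, a, b]) 1) (fun (_ acc : ℕ) => (fun (E : ℕ) => @List.rec ℕ (fun _ => ℕ) 0 (fun (x : ℕ) (_ : List ℕ) (acc : ℕ) => Nat.lor acc (Nat.shiftLeft E x)) [0, a, b]) acc) k) (Nat.shiftLeft acc c)) 62) (2 ^ 28972)) 2) 1) || !(Nat.beq (Nat.mod (Nat.div (@Nat.rec (fun _ => ℕ) 1 (fun (k acc : ℕ) => Nat.lor (@Nat.rec (fun _ => ℕ) ((fun (E : ℕ) => @List.rec ℕ (fun _ => ℕ) 0 (fun (x : ℕ) (_ : List ℕ) (acc : ℕ) => Nat.lor acc (Nat.shiftLeft E x)) [0, a, b]) 1) (fun (_ acc : ℕ) => (fun (E : ℕ)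 => @List.rec ℕ (fun _ => ℕ) 0 (fun (x : ℕ) (_ : List ℕ) (acc : ℕ) => Nat.lor acc (Nat.shiftLeft E x)) [0, a, b]) acc) k) (Nat.shiftLeft acc c)) 62) (2 ^ 28974)) 2) 1))))) && ih (c + 1)) true) ((HI' - ((b + 1) + (LO' - (b + 1))))) (((b + 1) + (LO' - (b + 1)))))) && ih (b + 1)) true) ((HI - ((a + 1) + (LO - (a + 1))))) (((a + 1) + (LO - (a + 1)))))) && ih (a + 1)) true) (28976 - (Z)) (Z)) = true → False := by
    intro Z LO HI LO' HI' hZ hLO hHI hLO' hHI' W0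
    have W1 := walk_true (p := fun (a : ℕ) => (Nat.ble (28972 + 2) a || Nat.beq (Nat.mod (Nat.div (Nat.lor (@Nat.rec (fun _ => ℕ) ((fun (E : ℕ) => @List.rec ℕ (fun _ => ℕ) 0 (fun (x : ℕ) (_ : List ℕ) (acc : ℕ) => Nat.lor acc (Nat.shiftLeft E x)) [0]) 1) (fun (_ acc : ℕ) => (fun (E : ℕ) => @List.rec ℕ (fun _ => ℕ) 0 (fun (x : ℕ) (_ : List ℕ) (acc : ℕ) => Nat.lor acc (Nat.shiftLeft E x)) [0]) acc) 61) (Nat.div (@Nat.rec (fun _ => ℕ) ((fun (E : ℕ) => @List.rec ℕ (fun _ => ℕ) 0 (fun (x : ℕ) (_ : List ℕ) (acc : ℕ) => Nat.lor acc (Nat.shiftLeft E x)) [0]) 1) (fun (_ acc : ℕ) => (fun (E : ℕ) => @List.rec ℕ (fun _ => ℕ) 0 (fun (x : ℕ) (_ : List ℕ) (acc : ℕ) => Nat.lor acc (Nat.shiftLeft E x)) [0]) acc) 61) 2)) (Nat.pow 2 (a - 2))) 2) 1)) (q := fun (a : ℕ) => (@Nat.rec (fun _ => ℕ → Bool) (fun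 _ => true) (fun (_ : ℕ) (ih : ℕ → Bool) (b : ℕ) => cond (Nat.beq (Nat.mod (Nat.lor (@Nat.rec (fun _ => ℕ) ((fun (E : ℕ) => @List.rec ℕ (fun _ => ℕ) 0 (fun (x : ℕ) (_ : List ℕ) (acc : ℕ) => Nat.lor acc (Nat.shiftLeft E x)) [0, a]) 1) (fun (_ acc : ℕ) => (fun (E : ℕ) => @List.rec ℕ (fun _ => ℕ) 0 (fun (x : ℕ) (_ : List ℕ) (acc : ℕ) => Nat.lor acc (Nat.shiftLeft E x)) [0, a]) acc) 61) (Nat.div (@Nat.rec (fun _ => ℕ) ((fun (E : ℕ) => @List.rec ℕ (fun _ => ℕ) 0 (fun (x : ℕ) (_ : List ℕ) (acc : ℕ) => Nat.lor acc (Nat.shiftLeft E x)) [0, a]) 1) (fun (_ acc : ℕ) => (fun (E : ℕ) => @List.rec ℕ (fun _ => ℕ) 0 (fun (x : ℕ) (_ : List ℕ) (acc : ℕ) => Nat.lor acc (Nat.shiftLeft E x)) [0, a]) acc) 61) 2)) (2 ^ ((b - 1) - ((b - 1) - 28972)))) (2 ^ ((b - 1) - ((b - 1) - 28972)) - 1))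 (((@Nat.rec (fun _ => ℕ → Bool) (fun _ => true) (fun (_ : ℕ) (ih : ℕ → Bool) (c : ℕ) => cond (Nat.beq (Nat.mod (Nat.lor (@Nat.rec (fun _ => ℕ) ((fun (E : ℕ) => @List.rec ℕ (fun _ => ℕ) 0 (fun (x : ℕ) (_ : List ℕ) (acc : ℕ) => Nat.lor acc (Nat.shiftLeft E x)) [0, a, b]) 1) (fun (_ acc : ℕ) => (fun (E : ℕ) => @List.rec ℕ (fun _ => ℕ) 0 (fun (x : ℕ) (_ : List ℕ) (acc : ℕ) => Nat.lor acc (Nat.shiftLeft E x)) [0, a, b]) acc) 61) (Nat.div (@Nat.rec (fun _ => ℕ) ((fun (E : ℕ) => @List.rec ℕ (fun _ => ℕ) 0 (fun (x : ℕ) (_ : List ℕ) (acc : ℕ) => Nat.lor acc (Nat.shiftLeft E x)) [0, a, b]) 1) (fun (_ acc : ℕ) => (fun (E : ℕ) => @List.rec ℕ (fun _ => ℕ) 0 (fun (x : ℕ) (_ : List ℕ) (acc : ℕ) => Nat.lor acc (Nat.shiftLeft E x)) [0, a, b]) acc) 61) 2)) (2 ^ ((c - 1) - ((c - 1) - 28972))))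 (2 ^ ((c - 1) - ((c - 1) - 28972)) - 1)) (((!(Nat.beq (Nat.mod (Nat.lor (@Nat.rec (fun _ => ℕ) 1 (fun (k acc : ℕ) => Nat.lor (@Nat.rec (fun _ => ℕ) ((fun (E : ℕ) => @List.rec ℕ (fun _ => ℕ) 0 (fun (x : ℕ) (_ : List ℕ) (acc : ℕ) => Nat.lor acc (Nat.shiftLeft E x)) [0, a, b]) 1) (fun (_ acc : ℕ) => (fun (E : ℕ) => @List.rec ℕ (fun _ => ℕ) 0 (fun (x : ℕ) (_ : List ℕ) (acc : ℕ) => Nat.lor acc (Nat.shiftLeft E x)) [0, a, b]) acc) k) (Nat.shiftLeft acc c)) 62) (Nat.div (@Nat.rec (fun _ => ℕ) 1 (fun (k acc : ℕ) => Nat.lor (@Nat.rec (fun _ => ℕ) ((fun (E : ℕ) => @List.rec ℕ (fun _ => ℕ) 0 (fun (x : ℕ) (_ : List ℕ) (acc : ℕ) => Nat.lor acc (Nat.shiftLeft E x)) [0, a, b]) 1) (fun (_ acc : ℕ) => (fun (E : ℕ) => @List.rec ℕ (fun _ => ℕ) 0 (fun (x : ℕ) (_ : List ℕ) (acc : ℕ)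 => Nat.lor acc (Nat.shiftLeft E x)) [0, a, b]) acc) k) (Nat.shiftLeft acc c)) 62) 2)) (2 ^ 28972)) (2 ^ 28972 - 1)) || (!(Nat.beq (Nat.mod (Nat.div (@Nat.rec (fun _ => ℕ) 1 (fun (k acc : ℕ) => Nat.lor (@Nat.rec (fun _ => ℕ) ((fun (E : ℕ) => @List.rec ℕ (fun _ => ℕ) 0 (fun (x : ℕ) (_ : List ℕ) (acc : ℕ) => Nat.lor acc (Nat.shiftLeft E x)) [0, a, b]) 1) (fun (_ acc : ℕ) => (fun (E : ℕ) => @List.rec ℕ (fun _ => ℕ) 0 (fun (x : ℕ) (_ : List ℕ) (acc : ℕ) => Nat.lor acc (Nat.shiftLeft E x)) [0, a, b]) acc) k) (Nat.shiftLeft acc c)) 62) (2 ^ 28973)) 2) 1) && (!(Nat.beq (Nat.mod (Nat.div (@Nat.rec (fun _ => ℕ) 1 (fun (k acc : ℕ) => Nat.lor (@Nat.rec (fun _ => ℕ) ((fun (E : ℕ) => @List.rec ℕ (fun _ => ℕ) 0 (fun (x : ℕ) (_ : List ℕ) (acc : ℕ) => Nat.lor acc (Nat.shiftLeft E x)) [0,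 a, b]) 1) (fun (_ acc : ℕ) => (fun (E : ℕ) => @List.rec ℕ (fun _ => ℕ) 0 (fun (x : ℕ) (_ : List ℕ) (acc : ℕ) => Nat.lor acc (Nat.shiftLeft E x)) [0, a, b]) acc) k) (Nat.shiftLeft acc c)) 62) (2 ^ 28972)) 2) 1) || !(Nat.beq (Nat.mod (Nat.div (@Nat.rec (fun _ => ℕ) 1 (fun (k acc : ℕ) => Nat.lor (@Nat.rec (fun _ => ℕ) ((fun (E : ℕ) => @List.rec ℕ (fun _ => ℕ) 0 (fun (x : ℕ) (_ : List ℕ) (acc : ℕ) => Nat.lor acc (Nat.shiftLeft E x)) [0, a, b]) 1) (fun (_ acc : ℕ) => (fun (E : ℕ) => @List.rec ℕ (fun _ => ℕ) 0 (fun (x : ℕ) (_ : List ℕ) (acc : ℕ) => Nat.lor acc (Nat.shiftLeft E x)) [0, a, b]) acc) k) (Nat.shiftLeft acc c)) 62) (2 ^ 28974)) 2) 1))))) && ih (c + 1)) true) ((HI' - ((b + 1) + (LO' - (b + 1))))) (((b + 1) + (LO' - (b + 1)))))) && ih (b + 1)) true) ((HI - ((a + 1) + (LO - (a + 1))))) (((a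 + 1) + (LO - (a + 1)))))) (28976 - (Z)) (Z) a (by omega) (by omega) (fun c' h1 h2 => hg0 c' (by omega) h2) W0
    have W2 := walk_true (p := fun (b : ℕ) => Nat.beq (Nat.mod (Nat.lor (@Nat.rec (fun _ => ℕ) ((fun (E : ℕ) => @List.rec ℕ (fun _ => ℕ) 0 (fun (x : ℕ) (_ : List ℕ) (acc : ℕ) => Nat.lor acc (Nat.shiftLeft E x)) [0, a]) 1) (fun (_ acc : ℕ) => (fun (E : ℕ) => @List.rec ℕ (fun _ => ℕ) 0 (fun (x : ℕ) (_ : List ℕ) (acc : ℕ) => Nat.lor acc (Nat.shiftLeft E x)) [0, a]) acc) 61) (Nat.div (@Nat.rec (fun _ => ℕ) ((fun (E : ℕ) => @List.rec ℕ (fun _ => ℕ) 0 (fun (x : ℕ) (_ : List ℕ) (acc : ℕ) => Nat.lor acc (Nat.shiftLeft E x)) [0, a]) 1) (fun (_ acc : ℕ) => (fun (E : ℕ) => @List.rec ℕ (fun _ => ℕ) 0 (fun (x : ℕ) (_ : List ℕ) (acc : ℕ) => Nat.lor acc (Nat.shiftLeft E x)) [0, a]) acc) 61) 2)) (2 ^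 ((b - 1) - ((b - 1) - 28972)))) (2 ^ ((b - 1) - ((b - 1) - 28972)) - 1)) (q := fun (b : ℕ) => (@Nat.rec (fun _ => ℕ → Bool) (fun _ => true) (fun (_ : ℕ) (ih : ℕ → Bool) (c : ℕ) => cond (Nat.beq (Nat.mod (Nat.lor (@Nat.rec (fun _ => ℕ) ((fun (E : ℕ) => @List.rec ℕ (fun _ => ℕ) 0 (fun (x : ℕ) (_ : List ℕ) (acc : ℕ) => Nat.lor acc (Nat.shiftLeft E x)) [0, a, b]) 1) (fun (_ acc : ℕ) => (fun (E : ℕ) => @List.rec ℕ (fun _ => ℕ) 0 (fun (x : ℕ) (_ : List ℕ) (acc : ℕ) => Nat.lor acc (Nat.shiftLeft E x)) [0, a, b]) acc) 61) (Nat.div (@Nat.rec (fun _ => ℕ) ((fun (E : ℕ) => @List.rec ℕ (fun _ => ℕ) 0 (fun (x : ℕ) (_ : List ℕ) (acc : ℕ) => Nat.lor acc (Nat.shiftLeft E x)) [0, a, b]) 1) (fun (_ acc : ℕ) => (fun (E : ℕ) => @List.rec ℕ (fun _ => ℕ) 0 (fun (x : ℕ) (_ : List ℕ) (acc : ℕ)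 => Nat.lor acc (Nat.shiftLeft E x)) [0, a, b]) acc) 61) 2)) (2 ^ ((c - 1) - ((c - 1) - 28972)))) (2 ^ ((c - 1) - ((c - 1) - 28972)) - 1)) (((!(Nat.beq (Nat.mod (Nat.lor (@Nat.rec (fun _ => ℕ) 1 (fun (k acc : ℕ) => Nat.lor (@Nat.rec (fun _ => ℕ) ((fun (E : ℕ) => @List.rec ℕ (fun _ => ℕ) 0 (fun (x : ℕ) (_ : List ℕ) (acc : ℕ) => Nat.lor acc (Nat.shiftLeft E x)) [0, a, b]) 1) (fun (_ acc : ℕ) => (fun (E : ℕ) => @List.rec ℕ (fun _ => ℕ) 0 (fun (x : ℕ) (_ : List ℕ) (acc : ℕ) => Nat.lor acc (Nat.shiftLeft E x)) [0, a, b]) acc) k) (Nat.shiftLeft acc c)) 62) (Nat.div (@Nat.rec (fun _ => ℕ) 1 (fun (k acc : ℕ) => Nat.lor (@Nat.rec (fun _ => ℕ) ((fun (E : ℕ) => @List.rec ℕ (fun _ => ℕ) 0 (fun (x : ℕ) (_ : List ℕ) (acc : ℕ) => Nat.lor acc (Nat.shiftLeft E x)) [0, a, b]) 1) (fun (_ acc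 : ℕ) => (fun (E : ℕ) => @List.rec ℕ (fun _ => ℕ) 0 (fun (x : ℕ) (_ : List ℕ) (acc : ℕ) => Nat.lor acc (Nat.shiftLeft E x)) [0, a, b]) acc) k) (Nat.shiftLeft acc c)) 62) 2)) (2 ^ 28972)) (2 ^ 28972 - 1)) || (!(Nat.beq (Nat.mod (Nat.div (@Nat.rec (fun _ => ℕ) 1 (fun (k acc : ℕ) => Nat.lor (@Nat.rec (fun _ => ℕ) ((fun (E : ℕ) => @List.rec ℕ (fun _ => ℕ) 0 (fun (x : ℕ) (_ : List ℕ) (acc : ℕ) => Nat.lor acc (Nat.shiftLeft E x)) [0, a, b]) 1) (fun (_ acc : ℕ) => (fun (E : ℕ) => @List.rec ℕ (fun _ => ℕ) 0 (fun (x : ℕ) (_ : List ℕ) (acc : ℕ) => Nat.lor acc (Nat.shiftLeft E x)) [0, a, b]) acc) k) (Nat.shiftLeft acc c)) 62) (2 ^ 28973)) 2) 1) && (!(Nat.beq (Nat.mod (Nat.div (@Nat.rec (fun _ => ℕ) 1 (fun (k acc : ℕ) => Nat.lor (@Nat.rec (fun _ => ℕ) ((fun (E : ℕ) => @List.rec ℕ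 (fun _ => ℕ) 0 (fun (x : ℕ) (_ : List ℕ) (acc : ℕ) => Nat.lor acc (Nat.shiftLeft E x)) [0, a, b]) 1) (fun (_ acc : ℕ) => (fun (E : ℕ) => @List.rec ℕ (fun _ => ℕ) 0 (fun (x : ℕ) (_ : List ℕ) (acc : ℕ) => Nat.lor acc (Nat.shiftLeft E x)) [0, a, b]) acc) k) (Nat.shiftLeft acc c)) 62) (2 ^ 28972)) 2) 1) || !(Nat.beq (Nat.mod (Nat.div (@Nat.rec (fun _ => ℕ) 1 (fun (k acc : ℕ) => Nat.lor (@Nat.rec (fun _ => ℕ) ((fun (E : ℕ) => @List.rec ℕ (fun _ => ℕ) 0 (fun (x : ℕ) (_ : List ℕ) (acc : ℕ) => Nat.lor acc (Nat.shiftLeft E x)) [0, a, b]) 1) (fun (_ acc : ℕ) => (fun (E : ℕ) => @List.rec ℕ (fun _ => ℕ) 0 (fun (x : ℕ) (_ : List ℕ) (acc : ℕ) => Nat.lor acc (Nat.shiftLeft E x)) [0, a, b]) acc) k) (Nat.shiftLeft acc c)) 62) (2 ^ 28974)) 2) 1))))) && ih (c + 1)) true) ((HI' - ((b + 1) + (LO'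 - (b + 1))))) (((b + 1) + (LO' - (b + 1)))))) ((HI - ((a + 1) + (LO - (a + 1))))) (((a + 1) + (LO - (a + 1)))) b (by omega) (by omega) (fun c' h1 h2 => rawAlive_of_testBit (t := (c' - 1) - ((c' - 1) - 28972)) (fun r hr => halive1 r (by omega))) W1
    have W3 := walk_true (p := fun (c : ℕ) => Nat.beq (Nat.mod (Nat.lor (@Nat.rec (fun _ => ℕ) ((fun (E : ℕ) => @List.rec ℕ (fun _ => ℕ) 0 (fun (x : ℕ) (_ : List ℕ) (acc : ℕ) => Nat.lor acc (Nat.shiftLeft E x)) [0, a, b]) 1) (fun (_ acc : ℕ) => (fun (E : ℕ) => @List.rec ℕ (fun _ => ℕ) 0 (fun (x : ℕ) (_ : List ℕ) (acc : ℕ) => Nat.lor acc (Nat.shiftLeft E x)) [0, a, b]) acc) 61) (Nat.div (@Nat.rec (fun _ => ℕ) ((fun (E : ℕ) => @List.rec ℕ (fun _ => ℕ) 0 (fun (x : ℕ) (_ : List ℕ) (acc : ℕ) => Nat.lor acc (Nat.shiftLeft E x)) [0, a, b]) 1) (fun (_ acc : ℕ) => (fun (E : ℕ) => @List.rec ℕ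 (fun _ => ℕ) 0 (fun (x : ℕ) (_ : List ℕ) (acc : ℕ) => Nat.lor acc (Nat.shiftLeft E x)) [0, a, b]) acc) 61) 2)) (2 ^ ((c - 1) - ((c - 1) - 28972)))) (2 ^ ((c - 1) - ((c - 1) - 28972)) - 1)) (q := fun (c : ℕ) => (!(Nat.beq (Nat.mod (Nat.lor (@Nat.rec (fun _ => ℕ) 1 (fun (k acc : ℕ) => Nat.lor (@Nat.rec (fun _ => ℕ) ((fun (E : ℕ) => @List.rec ℕ (fun _ => ℕ) 0 (fun (x : ℕ) (_ : List ℕ) (acc : ℕ) => Nat.lor acc (Nat.shiftLeft E x)) [0, a, b]) 1) (fun (_ acc : ℕ) => (fun (E : ℕ) => @List.rec ℕ (fun _ => ℕ) 0 (fun (x : ℕ) (_ : List ℕ) (acc : ℕ) => Nat.lor acc (Nat.shiftLeft E x)) [0, a, b]) acc) k) (Nat.shiftLeft acc c)) 62) (Nat.div (@Nat.rec (fun _ => ℕ) 1 (fun (k acc : ℕ) => Nat.lor (@Nat.rec (fun _ => ℕ) ((fun (E : ℕ) => @List.rec ℕ (fun _ => ℕ) 0 (fun (x : ℕ) (_ :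 List ℕ) (acc : ℕ) => Nat.lor acc (Nat.shiftLeft E x)) [0, a, b]) 1) (fun (_ acc : ℕ) => (fun (E : ℕ) => @List.rec ℕ (fun _ => ℕ) 0 (fun (x : ℕ) (_ : List ℕ) (acc : ℕ) => Nat.lor acc (Nat.shiftLeft E x)) [0, a, b]) acc) k) (Nat.shiftLeft acc c)) 62) 2)) (2 ^ 28972)) (2 ^ 28972 - 1)) || (!(Nat.beq (Nat.mod (Nat.div (@Nat.rec (fun _ => ℕ) 1 (fun (k acc : ℕ) => Nat.lor (@Nat.rec (fun _ => ℕ) ((fun (E : ℕ) => @List.rec ℕ (fun _ => ℕ) 0 (fun (x : ℕ) (_ : List ℕ) (acc : ℕ) => Nat.lor acc (Nat.shiftLeft E x)) [0, a, b]) 1) (fun (_ acc : ℕ) => (fun (E : ℕ) => @List.rec ℕ (fun _ => ℕ) 0 (fun (x : ℕ) (_ : List ℕ) (acc : ℕ) => Nat.lor acc (Nat.shiftLeft E x)) [0, a, b]) acc) k) (Nat.shiftLeft acc c)) 62) (2 ^ 28973)) 2) 1) && (!(Nat.beq (Nat.mod (Nat.div (@Nat.rec (fun _ => ℕ) 1 (fun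 (k acc : ℕ) => Nat.lor (@Nat.rec (fun _ => ℕ) ((fun (E : ℕ) => @List.rec ℕ (fun _ => ℕ) 0 (fun (x : ℕ) (_ : List ℕ) (acc : ℕ) => Nat.lor acc (Nat.shiftLeft E x)) [0, a, b]) 1) (fun (_ acc : ℕ) => (fun (E : ℕ) => @List.rec ℕ (fun _ => ℕ) 0 (fun (x : ℕ) (_ : List ℕ) (acc : ℕ) => Nat.lor acc (Nat.shiftLeft E x)) [0, a, b]) acc) k) (Nat.shiftLeft acc c)) 62) (2 ^ 28972)) 2) 1) || !(Nat.beq (Nat.mod (Nat.div (@Nat.rec (fun _ => ℕ) 1 (fun (k acc : ℕ) => Nat.lor (@Nat.rec (fun _ => ℕ) ((fun (E : ℕ) => @List.rec ℕ (fun _ => ℕ) 0 (fun (x : ℕ) (_ : List ℕ) (acc : ℕ) => Nat.lor acc (Nat.shiftLeft E x)) [0, a, b]) 1) (fun (_ acc : ℕ) => (fun (E : ℕ) => @List.rec ℕ (fun _ => ℕ) 0 (fun (x : ℕ) (_ : List ℕ) (acc : ℕ) => Nat.lor acc (Nat.shiftLeft E x)) [0, a, b]) acc) k) (Nat.shiftLeft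 acc c)) 62) (2 ^ 28974)) 2) 1))))) ((HI' - ((b + 1) + (LO' - (b + 1))))) (((b + 1) + (LO' - (b + 1)))) c (by omega) (by omega) (fun c' h1 h2 => rawAlive_of_testBit (t := (c' - 1) - ((c' - 1) - 28972)) (fun r hr => halive2 r (by omega))) W2
    have WL : ((!(Nat.beq (Nat.mod (Nat.lor (@Nat.rec (fun _ => ℕ) 1 (fun (k acc : ℕ) => Nat.lor (@Nat.rec (fun _ => ℕ) ((fun (E : ℕ) => @List.rec ℕ (fun _ => ℕ) 0 (fun (x : ℕ) (_ : List ℕ) (acc : ℕ) => Nat.lor acc (Nat.shiftLeft E x)) [0, a, b]) 1) (fun (_ acc : ℕ) => (fun (E : ℕ) => @List.rec ℕ (fun _ => ℕ) 0 (fun (x : ℕ) (_ : List ℕ) (acc : ℕ) => Nat.lor acc (Nat.shiftLeft E x)) [0, a, b]) acc) k) (Nat.shiftLeft acc c)) 62) (Nat.div (@Nat.rec (fun _ => ℕ) 1 (fun (k acc : ℕ) => Nat.lor (@Nat.rec (fun _ => ℕ) ((fun (E : ℕ) => @List.rec ℕ (fun _ => ℕ) 0 (fun (x : ℕ) (_ :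 List ℕ) (acc : ℕ) => Nat.lor acc (Nat.shiftLeft E x)) [0, a, b]) 1) (fun (_ acc : ℕ) => (fun (E : ℕ) => @List.rec ℕ (fun _ => ℕ) 0 (fun (x : ℕ) (_ : List ℕ) (acc : ℕ) => Nat.lor acc (Nat.shiftLeft E x)) [0, a, b]) acc) k) (Nat.shiftLeft acc c)) 62) 2)) (2 ^ 28972)) (2 ^ 28972 - 1)) || (!(Nat.beq (Nat.mod (Nat.div (@Nat.rec (fun _ => ℕ) 1 (fun (k acc : ℕ) => Nat.lor (@Nat.rec (fun _ => ℕ) ((fun (E : ℕ) => @List.rec ℕ (fun _ => ℕ) 0 (fun (x : ℕ) (_ : List ℕ) (acc : ℕ) => Nat.lor acc (Nat.shiftLeft E x)) [0, a, b]) 1) (fun (_ acc : ℕ) => (fun (E : ℕ) => @List.rec ℕ (fun _ => ℕ) 0 (fun (x : ℕ) (_ : List ℕ) (acc : ℕ) => Nat.lor acc (Nat.shiftLeft E x)) [0, a, b]) acc) k) (Nat.shiftLeft acc c)) 62) (2 ^ 28973)) 2) 1) && (!(Nat.beq (Nat.mod (Nat.div (@Nat.rec (fun _ => ℕ) 1 (fun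 (k acc : ℕ) => Nat.lor (@Nat.rec (fun _ => ℕ) ((fun (E : ℕ) => @List.rec ℕ (fun _ => ℕ) 0 (fun (x : ℕ) (_ : List ℕ) (acc : ℕ) => Nat.lor acc (Nat.shiftLeft E x)) [0, a, b]) 1) (fun (_ acc : ℕ) => (fun (E : ℕ) => @List.rec ℕ (fun _ => ℕ) 0 (fun (x : ℕ) (_ : List ℕ) (acc : ℕ) => Nat.lor acc (Nat.shiftLeft E x)) [0, a, b]) acc) k) (Nat.shiftLeft acc c)) 62) (2 ^ 28972)) 2) 1) || !(Nat.beq (Nat.mod (Nat.div (@Nat.rec (fun _ => ℕ) 1 (fun (k acc : ℕ) => Nat.lor (@Nat.rec (fun _ => ℕ) ((fun (E : ℕ) => @List.rec ℕ (fun _ => ℕ) 0 (fun (x : ℕ) (_ : List ℕ) (acc : ℕ) => Nat.lor acc (Nat.shiftLeft E x)) [0, a, b]) 1) (fun (_ acc : ℕ) => (fun (E : ℕ) => @List.rec ℕ (fun _ => ℕ) 0 (fun (x : ℕ) (_ : List ℕ) (acc : ℕ) => Nat.lor acc (Nat.shiftLeft E x)) [0, a, b]) acc) k) (Nat.shiftLeft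 acc c)) 62) (2 ^ 28974)) 2) 1))))) = true := W3
    rw [hleafA] at WL
    simp only [Bool.not_true, Bool.false_or, Bool.and_eq_true, Bool.or_eq_true, Bool.not_eq_true'] at WL
    obtain ⟨hnoT1, hnoT0T2⟩ := WL
    have hcontra : ∀ r, r ≤ 28974 →
        r ∈ (Finset.univ : Finset (Sym (Fin 4) 62)).image (fun s : Sym (Fin 4) 62 => ((s : Multiset (Fin 4)).map d).sum) →
        Nat.beq (Nat.mod (Nat.div (@Nat.rec (fun _ => ℕ) 1 (fun (k acc : ℕ) => Nat.lor (@Nat.rec (fun _ => ℕ) ((fun (E : ℕ) => @List.rec ℕ (fun _ => ℕ) 0 (fun (x : ℕ) (_ : List ℕ) (acc : ℕ) => Nat.lor acc (Nat.shiftLeft E x)) [0, a, b]) 1) (fun (_ acc : ℕ) => (fun (E : ℕ) => @List.rec ℕ (fun _ => ℕ) 0 (fun (x : ℕ) (_ : List ℕ) (acc : ℕ) => Nat.lor acc (Nat.shiftLeft E x)) [0, a, b]) acc) k) (Nat.shiftLeft acc c)) 62) (2 ^ r)) 2) 1 = false → False := by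
      intro r hr h hf
      have hb := hbit r hr h
      rw [hf] at hb
      exact Bool.false_ne_true hb
    rcases Nat.lt_or_ge (pencil d S).det.natDegree 28975 with hsmall | hbig
    · interval_cases h : (pencil d S).det.natDegree
      · exact hcontra 28973 (by omega) htop0 hnoT1
      · rcases hchain0 28972 (by omega) with h' | h'
        · rcases hnoT0T2 with hf | hf
          · exact hcontra 28972 (by omega) h' hf
          · exact hcontra 28974 (by omega) htop0 hf
        · exact hcontra 28973 (by omega) h' hnoT1
    · rcases hchain0 28972 (by omega) with h1 | h1
      · rcases hchain0 28973 (by omega) with h2 | h2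
        · exact hcontra 28973 (by omega) h2 hnoT1
        · rcases hnoT0T2 with hf | hf
          · exact hcontra 28972 (by omega) h1 hf
          · exact hcontra 28974 (by omega) h2 hf
      · exact hcontra 28973 (by omega) h1 hnoT1
  rcases Nat.lt_or_ge b 24 with hlt_s | hge1
  · rcases Nat.lt_or_ge c 83 with hlt_t | hgi1
    · exact peel 1 0 24 0 83 rfl (Nat.zero_le _) hlt_s (Nat.zero_le _) hlt_t sectorWalk_sixtytwo_four_s2_0_24_s3_0_83
    · rcases Nat.lt_or_ge c 153 with hlt_t | hgi2
      · exact peel 1 0 24 83 153 rfl (Nat.zero_le _) hlt_s hgi1 hlt_t sectorWalk_sixtytwo_four_s2_0_24_s3_83_153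
      · rcases Nat.lt_or_ge c 226 with hlt_t | hgi3
        · exact peel 1 0 24 153 226 rfl (Nat.zero_le _) hlt_s hgi2 hlt_t sectorWalk_sixtytwo_four_s2_0_24_s3_153_226
        · rcases Nat.lt_or_ge c 303 with hlt_t | hgi4
          · exact peel 1 0 24 226 303 rfl (Nat.zero_le _) hlt_s hgi3 hlt_t sectorWalk_sixtytwo_four_s2_0_24_s3_226_303
          · rcases Nat.lt_or_ge c 387 with hlt_t | hgi5
            · exact peel 1 0 24 303 387 rfl (Nat.zero_le _) hlt_s hgi4 hlt_t sectorWalk_sixtytwo_four_s2_0_24_s3_303_387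
            · rcases Nat.lt_or_ge c 479 with hlt_t | hgi6
              · exact peel 1 0 24 387 479 rfl (Nat.zero_le _) hlt_s hgi5 hlt_t sectorWalk_sixtytwo_four_s2_0_24_s3_387_479
              · rcases Nat.lt_or_ge c 583 with hlt_t | hgi7
                · exact peel 1 0 24 479 583 rfl (Nat.zero_le _) hlt_s hgi6 hlt_t sectorWalk_sixtytwo_four_s2_0_24_s3_479_583
                · rcases Nat.lt_or_ge c 706 with hlt_t | hgi8
                  · exact peel 1 0 24 583 706 rfl (Nat.zero_le _) hlt_s hgi7 hlt_t sectorWalk_sixtytwo_four_s2_0_24_s3_583_706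
                  · rcases Nat.lt_or_ge c 878 with hlt_t | hgi9
                    · exact peel 1 0 24 706 878 rfl (Nat.zero_le _) hlt_s hgi8 hlt_t sectorWalk_sixtytwo_four_s2_0_24_s3_706_878
                    · exact peel 1 0 24 878 28976 rfl (Nat.zero_le _) hlt_s hgi9 (hltC c (by simp)) sectorWalk_sixtytwo_four_s2_0_24_s3_878_28976
  · rcases Nat.lt_or_ge b 36 with hlt_s | hge2
    · rcases Nat.lt_or_ge c 155 with hlt_t | hgi1
      · exact peel 1 24 36 0 155 rfl hge1 hlt_s (Nat.zero_le _) hlt_t sectorWalk_sixtytwo_four_s2_24_36_s3_0_155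
      · rcases Nat.lt_or_ge c 280 with hlt_t | hgi2
        · exact peel 1 24 36 155 280 rfl hge1 hlt_s hgi1 hlt_t sectorWalk_sixtytwo_four_s2_24_36_s3_155_280
        · rcases Nat.lt_or_ge c 405 with hlt_t | hgi3
          · exact peel 1 24 36 280 405 rfl hge1 hlt_s hgi2 hlt_t sectorWalk_sixtytwo_four_s2_24_36_s3_280_405
          · rcases Nat.lt_or_ge c 530 with hlt_t | hgi4
            · exact peel 1 24 36 405 530 rfl hge1 hlt_s hgi3 hlt_t sectorWalk_sixtytwo_four_s2_24_36_s3_405_530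
            · rcases Nat.lt_or_ge c 655 with hlt_t | hgi5
              · exact peel 1 24 36 530 655 rfl hge1 hlt_s hgi4 hlt_t sectorWalk_sixtytwo_four_s2_24_36_s3_530_655
              · rcases Nat.lt_or_ge c 780 with hlt_t | hgi6
                · exact peel 1 24 36 655 780 rfl hge1 hlt_s hgi5 hlt_t sectorWalk_sixtytwo_four_s2_24_36_s3_655_780
                · rcases Nat.lt_or_ge c 905 with hlt_t | hgi7
                  · exact peel 1 24 36 780 905 rfl hge1 hlt_s hgi6 hlt_t sectorWalk_sixtytwo_four_s2_24_36_s3_780_905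
                  · rcases Nat.lt_or_ge c 1031 with hlt_t | hgi8
                    · exact peel 1 24 36 905 1031 rfl hge1 hlt_s hgi7 hlt_t sectorWalk_sixtytwo_four_s2_24_36_s3_905_1031
                    · rcases Nat.lt_or_ge c 1244 with hlt_t | hgi9
                      · exact peel 1 24 36 1031 1244 rfl hge1 hlt_s hgi8 hlt_t sectorWalk_sixtytwo_four_s2_24_36_s3_1031_1244
                      · exact peel 1 24 36 1244 28976 rfl hge1 hlt_s hgi9 (hltC c (by simp)) sectorWalk_sixtytwo_four_s2_24_36_s3_1244_28976
    · rcases Nat.lt_or_ge b 46 with hlt_s | hge3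
      · rcases Nat.lt_or_ge c 191 with hlt_t | hgi1
        · exact peel 1 36 46 0 191 rfl hge2 hlt_s (Nat.zero_le _) hlt_t sectorWalk_sixtytwo_four_s2_36_46_s3_0_191
        · rcases Nat.lt_or_ge c 341 with hlt_t | hgi2
          · exact peel 1 36 46 191 341 rfl hge2 hlt_s hgi1 hlt_t sectorWalk_sixtytwo_four_s2_36_46_s3_191_341
          · rcases Nat.lt_or_ge c 491 with hlt_t | hgi3
            · exact peel 1 36 46 341 491 rfl hge2 hlt_s hgi2 hlt_t sectorWalk_sixtytwo_four_s2_36_46_s3_341_491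
            · rcases Nat.lt_or_ge c 641 with hlt_t | hgi4
              · exact peel 1 36 46 491 641 rfl hge2 hlt_s hgi3 hlt_t sectorWalk_sixtytwo_four_s2_36_46_s3_491_641
              · rcases Nat.lt_or_ge c 791 with hlt_t | hgi5
                · exact peel 1 36 46 641 791 rfl hge2 hlt_s hgi4 hlt_t sectorWalk_sixtytwo_four_s2_36_46_s3_641_791
                · rcases Nat.lt_or_ge c 941 with hlt_t | hgi6
                  · exact peel 1 36 46 791 941 rfl hge2 hlt_s hgi5 hlt_t sectorWalk_sixtytwo_four_s2_36_46_s3_791_941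
                  · rcases Nat.lt_or_ge c 1157 with hlt_t | hgi7
                    · exact peel 1 36 46 941 1157 rfl hge2 hlt_s hgi6 hlt_t sectorWalk_sixtytwo_four_s2_36_46_s3_941_1157
                    · rcases Nat.lt_or_ge c 1457 with hlt_t | hgi8
                      · exact peel 1 36 46 1157 1457 rfl hge2 hlt_s hgi7 hlt_t sectorWalk_sixtytwo_four_s2_36_46_s3_1157_1457
                      · rcases Nat.lt_or_ge c 1779 with hlt_t | hgi9
                        · exact peel 1 36 46 1457 1779 rfl hge2 hlt_s hgi8 hlt_t sectorWalk_sixtytwo_four_s2_36_46_s3_1457_1779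
                        · exact peel 1 36 46 1779 28976 rfl hge2 hlt_s hgi9 (hltC c (by simp)) sectorWalk_sixtytwo_four_s2_36_46_s3_1779_28976
      · rcases Nat.lt_or_ge b 57 with hlt_s | hge4
        · rcases Nat.lt_or_ge c 188 with hlt_t | hgi1
          · exact peel 1 46 57 0 188 rfl hge3 hlt_s (Nat.zero_le _) hlt_t sectorWalk_sixtytwo_four_s2_46_57_s3_0_188
          · rcases Nat.lt_or_ge c 324 with hlt_t | hgi2
            · exact peel 1 46 57 188 324 rfl hge3 hlt_s hgi1 hlt_t sectorWalk_sixtytwo_four_s2_46_57_s3_188_324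
            · rcases Nat.lt_or_ge c 460 with hlt_t | hgi3
              · exact peel 1 46 57 324 460 rfl hge3 hlt_s hgi2 hlt_t sectorWalk_sixtytwo_four_s2_46_57_s3_324_460
              · rcases Nat.lt_or_ge c 598 with hlt_t | hgi4
                · exact peel 1 46 57 460 598 rfl hge3 hlt_s hgi3 hlt_t sectorWalk_sixtytwo_four_s2_46_57_s3_460_598
                · rcases Nat.lt_or_ge c 758 with hlt_t | hgi5
                  · exact peel 1 46 57 598 758 rfl hge3 hlt_s hgi4 hlt_t sectorWalk_sixtytwo_four_s2_46_57_s3_598_758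
                  · rcases Nat.lt_or_ge c 982 with hlt_t | hgi6
                    · exact peel 1 46 57 758 982 rfl hge3 hlt_s hgi5 hlt_t sectorWalk_sixtytwo_four_s2_46_57_s3_758_982
                    · rcases Nat.lt_or_ge c 1254 with hlt_t | hgi7
                      · exact peel 1 46 57 982 1254 rfl hge3 hlt_s hgi6 hlt_t sectorWalk_sixtytwo_four_s2_46_57_s3_982_1254
                      · rcases Nat.lt_or_ge c 1526 with hlt_t | hgi8
                        · exact peel 1 46 57 1254 1526 rfl hge3 hlt_s hgi7 hlt_t sectorWalk_sixtytwo_four_s2_46_57_s3_1254_1526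
                        · rcases Nat.lt_or_ge c 1798 with hlt_t | hgi9
                          · exact peel 1 46 57 1526 1798 rfl hge3 hlt_s hgi8 hlt_t sectorWalk_sixtytwo_four_s2_46_57_s3_1526_1798
                          · exact peel 1 46 57 1798 28976 rfl hge3 hlt_s hgi9 (hltC c (by simp)) sectorWalk_sixtytwo_four_s2_46_57_s3_1798_28976
        · rcases Nat.lt_or_ge b 70 with hlt_s | hge5
          · rcases Nat.lt_or_ge c 210 with hlt_t | hgi1
            · exact peel 1 57 70 0 210 rfl hge4 hlt_s (Nat.zero_le _) hlt_t sectorWalk_sixtytwo_four_s2_57_70_s3_0_210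
            · rcases Nat.lt_or_ge c 379 with hlt_t | hgi2
              · exact peel 1 57 70 210 379 rfl hge4 hlt_s hgi1 hlt_t sectorWalk_sixtytwo_four_s2_57_70_s3_210_379
              · rcases Nat.lt_or_ge c 590 with hlt_t | hgi3
                · exact peel 1 57 70 379 590 rfl hge4 hlt_s hgi2 hlt_t sectorWalk_sixtytwo_four_s2_57_70_s3_379_590
                · rcases Nat.lt_or_ge c 820 with hlt_t | hgi4
                  · exact peel 1 57 70 590 820 rfl hge4 hlt_s hgi3 hlt_t sectorWalk_sixtytwo_four_s2_57_70_s3_590_820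
                  · rcases Nat.lt_or_ge c 1050 with hlt_t | hgi5
                    · exact peel 1 57 70 820 1050 rfl hge4 hlt_s hgi4 hlt_t sectorWalk_sixtytwo_four_s2_57_70_s3_820_1050
                    · rcases Nat.lt_or_ge c 1280 with hlt_t | hgi6
                      · exact peel 1 57 70 1050 1280 rfl hge4 hlt_s hgi5 hlt_t sectorWalk_sixtytwo_four_s2_57_70_s3_1050_1280
                      · rcases Nat.lt_or_ge c 1510 with hlt_t | hgi7
                        · exact peel 1 57 70 1280 1510 rfl hge4 hlt_s hgi6 hlt_t sectorWalk_sixtytwo_four_s2_57_70_s3_1280_1510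
                        · rcases Nat.lt_or_ge c 1740 with hlt_t | hgi8
                          · exact peel 1 57 70 1510 1740 rfl hge4 hlt_s hgi7 hlt_t sectorWalk_sixtytwo_four_s2_57_70_s3_1510_1740
                          · rcases Nat.lt_or_ge c 1970 with hlt_t | hgi9
                            · exact peel 1 57 70 1740 1970 rfl hge4 hlt_s hgi8 hlt_t sectorWalk_sixtytwo_four_s2_57_70_s3_1740_1970
                            · exact peel 1 57 70 1970 28976 rfl hge4 hlt_s hgi9 (hltC c (by simp)) sectorWalk_sixtytwo_four_s2_57_70_s3_1970_28976
          · rcases Nat.lt_or_ge b 85 with hlt_s | hge6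
            · rcases Nat.lt_or_ge c 278 with hlt_t | hgi1
              · exact peel 1 70 85 0 278 rfl hge5 hlt_s (Nat.zero_le _) hlt_t sectorWalk_sixtytwo_four_s2_70_85_s3_0_278
              · rcases Nat.lt_or_ge c 478 with hlt_t | hgi2
                · exact peel 1 70 85 278 478 rfl hge5 hlt_s hgi1 hlt_t sectorWalk_sixtytwo_four_s2_70_85_s3_278_478
                · rcases Nat.lt_or_ge c 678 with hlt_t | hgi3
                  · exact peel 1 70 85 478 678 rfl hge5 hlt_s hgi2 hlt_t sectorWalk_sixtytwo_four_s2_70_85_s3_478_678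
                  · rcases Nat.lt_or_ge c 878 with hlt_t | hgi4
                    · exact peel 1 70 85 678 878 rfl hge5 hlt_s hgi3 hlt_t sectorWalk_sixtytwo_four_s2_70_85_s3_678_878
                    · rcases Nat.lt_or_ge c 1078 with hlt_t | hgi5
                      · exact peel 1 70 85 878 1078 rfl hge5 hlt_s hgi4 hlt_t sectorWalk_sixtytwo_four_s2_70_85_s3_878_1078
                      · rcases Nat.lt_or_ge c 1278 with hlt_t | hgi6
                        · exact peel 1 70 85 1078 1278 rfl hge5 hlt_s hgi5 hlt_t sectorWalk_sixtytwo_four_s2_70_85_s3_1078_1278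
                        · rcases Nat.lt_or_ge c 1478 with hlt_t | hgi7
                          · exact peel 1 70 85 1278 1478 rfl hge5 hlt_s hgi6 hlt_t sectorWalk_sixtytwo_four_s2_70_85_s3_1278_1478
                          · rcases Nat.lt_or_ge c 1678 with hlt_t | hgi8
                            · exact peel 1 70 85 1478 1678 rfl hge5 hlt_s hgi7 hlt_t sectorWalk_sixtytwo_four_s2_70_85_s3_1478_1678
                            · rcases Nat.lt_or_ge c 1878 with hlt_t | hgi9
                              · exact peel 1 70 85 1678 1878 rfl hge5 hlt_s hgi8 hlt_t sectorWalk_sixtytwo_four_s2_70_85_s3_1678_1878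
                              · exact peel 1 70 85 1878 28976 rfl hge5 hlt_s hgi9 (hltC c (by simp)) sectorWalk_sixtytwo_four_s2_70_85_s3_1878_28976
            · rcases Nat.lt_or_ge b 104 with hlt_s | hge7
              · rcases Nat.lt_or_ge c 252 with hlt_t | hgi1
                · exact peel 1 85 104 0 252 rfl hge6 hlt_s (Nat.zero_le _) hlt_t sectorWalk_sixtytwo_four_s2_85_104_s3_0_252
                · rcases Nat.lt_or_ge c 409 with hlt_t | hgi2
                  · exact peel 1 85 104 252 409 rfl hge6 hlt_s hgi1 hlt_t sectorWalk_sixtytwo_four_s2_85_104_s3_252_409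
                  · rcases Nat.lt_or_ge c 566 with hlt_t | hgi3
                    · exact peel 1 85 104 409 566 rfl hge6 hlt_s hgi2 hlt_t sectorWalk_sixtytwo_four_s2_85_104_s3_409_566
                    · rcases Nat.lt_or_ge c 723 with hlt_t | hgi4
                      · exact peel 1 85 104 566 723 rfl hge6 hlt_s hgi3 hlt_t sectorWalk_sixtytwo_four_s2_85_104_s3_566_723
                      · rcases Nat.lt_or_ge c 880 with hlt_t | hgi5
                        · exact peel 1 85 104 723 880 rfl hge6 hlt_s hgi4 hlt_t sectorWalk_sixtytwo_four_s2_85_104_s3_723_880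
                        · rcases Nat.lt_or_ge c 1037 with hlt_t | hgi6
                          · exact peel 1 85 104 880 1037 rfl hge6 hlt_s hgi5 hlt_t sectorWalk_sixtytwo_four_s2_85_104_s3_880_1037
                          · rcases Nat.lt_or_ge c 1194 with hlt_t | hgi7
                            · exact peel 1 85 104 1037 1194 rfl hge6 hlt_s hgi6 hlt_t sectorWalk_sixtytwo_four_s2_85_104_s3_1037_1194
                            · rcases Nat.lt_or_ge c 1352 with hlt_t | hgi8
                              · exact peel 1 85 104 1194 1352 rfl hge6 hlt_s hgi7 hlt_t sectorWalk_sixtytwo_four_s2_85_104_s3_1194_1352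
                              · rcases Nat.lt_or_ge c 1536 with hlt_t | hgi9
                                · exact peel 1 85 104 1352 1536 rfl hge6 hlt_s hgi8 hlt_t sectorWalk_sixtytwo_four_s2_85_104_s3_1352_1536
                                · exact peel 1 85 104 1536 28976 rfl hge6 hlt_s hgi9 (hltC c (by simp)) sectorWalk_sixtytwo_four_s2_85_104_s3_1536_28976
              · rcases Nat.lt_or_ge c 246 with hlt_t | hgi1
                · exact peel 1 104 28976 0 246 rfl hge7 (hltC b (by simp)) (Nat.zero_le _) hlt_t sectorWalk_sixtytwo_four_s2_104_28976_s3_0_246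
                · rcases Nat.lt_or_ge c 390 with hlt_t | hgi2
                  · exact peel 1 104 28976 246 390 rfl hge7 (hltC b (by simp)) hgi1 hlt_t sectorWalk_sixtytwo_four_s2_104_28976_s3_246_390
                  · rcases Nat.lt_or_ge c 555 with hlt_t | hgi3
                    · exact peel 1 104 28976 390 555 rfl hge7 (hltC b (by simp)) hgi2 hlt_t sectorWalk_sixtytwo_four_s2_104_28976_s3_390_555
                    · rcases Nat.lt_or_ge c 756 with hlt_t | hgi4
                      · exact peel 1 104 28976 555 756 rfl hge7 (hltC b (by simp)) hgi3 hlt_t sectorWalk_sixtytwo_four_s2_104_28976_s3_555_756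
                      · rcases Nat.lt_or_ge c 1055 with hlt_t | hgi5
                        · exact peel 1 104 28976 756 1055 rfl hge7 (hltC b (by simp)) hgi4 hlt_t sectorWalk_sixtytwo_four_s2_104_28976_s3_756_1055
                        · exact peel 1 104 28976 1055 28976 rfl hge7 (hltC b (by simp)) hgi5 (hltC c (by simp)) sectorWalk_sixtytwo_four_s2_104_28976_s3_1055_28976

end Summit.ValiantsHypothesis.ValiantsHypothesis.Theorems.LacunarySymmetroidMatrixDescartes.FiniteSector
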